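import Mathlib
import HarnessLib
import Summits.HubbardSuperconductivity.HubbardSuperconductivity.Theorems.KLProgrammeKLRegimeTwoVolumeLipBudgetStep
import Summits.HubbardSuperconductivity.HubbardSuperconductivity.Theorems.KLProgrammeKLRegimeTwoVolumeLipRowUnits
import Summits.HubbardSuperconductivity.HubbardSuperconductivity.Theorems.KLProgrammeKLRegimeEngineTowerLipschitzGeomBudget

/-!
# Route `KLProgramme` — crux K3 ENGINE (stmt-HubbardSuperconductivity-20437 `KLRegimeEngineV17F2`), stub (e) proof-input «(e)-D-ROWS», F-D7: THE TWO-VOLUME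
# LIPSCHITZ TOWER LAW AT THE MODEL FROM NAMED PER-BLOCK ROWS — `EngineV8.towerDiff_le_of_geomBudget` INSTANTIATED
# (seat hubbard-kl-k3c4-p1 g25, VL lane; `--supports` 20437; DROWS-SCOPE-g25 §13.6: vehicle p723651, step p725279 (∘ LINK p723305 ∘ free-rate chain
#  p721878/p722069/p722288), row p724775 (∘ p722475); the two-volume twin of E1's W5 `klTowerBornWtAt_le_law_of_blocks_klEng_tokX` BEFORE the block data are
#  discharged from the regime)

WHAT IS DISCHARGED HERE: the induction over the blocks (geometric budget `R k = R₁Θ^{k−1}`, all degree indices `1 ≤ p ≤ D`), the Lipschitz step of every block (the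
LINK + the step images) and the re-measurement row of every block (the (Dμ) row in floor units).  WHAT STAYS A NAMED ROW (DROWS-SCOPE-g25 §13.2/§13.6, by supplier):
N1 the tokens `Z^K_{bL,Λ_{dk}}, Z^K_{L,Λ_{dk}} ≠ 0`; N2–N3 the Gram / glued-weight-decay envelopes of the FINE block covariances at the common frame (E1's `_vol` suppliers);
N4 the one-volume majorant profiles (E1's W-law third conjunct at both volumes, in the scaling `32(cW²/8)^m`); N5 the one-step transfer rows and the jump rows
`cWJ k k′ ≤ C_J·2^{dk−1−dk′}` (E1 overlap rows + fine-sector count); N6 coarse born profiles; N7 covariance-defect sources; N8 the base; N13 the block-`0` born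
difference (inside the row source `sμ`); the soft kit conditions (E1's regime at E1's `σ̄ τ̄ ψ̄ Φ̄`); and the closing ARITHMETIC (`χ_m = (32/2^m)^d < Θ`, the profile
envelope, `C + S ≤ Θ·X_b`, the source budgets) — numbers, no model content.

* **`klLipBornDiffSup_le_law_of_rows`**.

Composition of landed theorems; nothing about the model is asserted beyond the named rows; nothing asserts the (D) rows, stub (e), VL, K3 or superconductivity.
References: BGM 2006 §2.8 (2.76)–(2.98), §3 (3.2)–(3.8) [cite: BenfattoGiulianiMastropietro2006]; Gawȩdzki–Kupiainen 1985 §3.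
-/

noncomputable section

namespace Summit.HubbardSuperconductivity.HubbardSuperconductivity.Theorems.TwoVolumeLip

set_option linter.dupNamespace false -- summit = problem name (single-conjunct summit), D-0017

open Finset Literature.MathematicalPhysics.QuantumLattice GrassmannAlgebra Literature.Probability.LatticeModels
  Literature.Probability.LatticeModels.BattleFederbush
open Literature.MathematicalPhysics.QuantumLattice.FermiRG
open Summit.HubbardSuperconductivity.HubbardSuperconductivity.Theorems.KLRegimeSplit
open Summit.HubbardSuperconductivity.HubbardSuperconductivity.Theorems.KLProgrammeLegKernels
open Summit.HubbardSuperconductivity.HubbardSuperconductivity.Theorems.DispersionFlow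
open Summit.HubbardSuperconductivity.HubbardSuperconductivity.Theorems.EngineV8
open Summit.HubbardSuperconductivity.HubbardSuperconductivity.Theorems.TwoVolumeSource
open Summit.HubbardSuperconductivity.HubbardSuperconductivity.Theorems.TwoVolumeDefect

variable {L b M : ℕ} [NeZero L] [NeZero (b * L)] [NeZero M]

set_option maxHeartbeats 3200000 in -- very large statement (the whole per-block data of the two-volume tower) and two long compositions
/-- **THE TWO-VOLUME LIPSCHITZ TOWER LAW AT THE MODEL, FROM NAMED PER-BLOCK ROWS** (F-D7 = `EngineV8.towerDiff_le_of_geomBudget` at the model, `hstep` :=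
`…TwoVolumeLipBudgetStep`, `hrow` := `…TwoVolumeLipRowUnits`).  Fine torus `bL ⊃` coarse `L`, common frame `K`, block length `d ≥ 2`, blocks `1 ≤ k < K_b`, one weight
rate `j_w` (zone) and one transfer rate `j_r`, degree cap `D ≥ 3`, depth schedule `R_in(k) = Din k + r`, `D₀(k) = Din k + r + R′`, `R_out(k) = Din k + r + R′ + r`
(`2r ≤ Din k`, `R_out(k′) ≤ Din k` for `1 ≤ k′ < k`), budget `R k = R₁Θ^{k−1}`.  HYPOTHESES (all per block, named): the LINK's data (tokens N1, Gram/decay envelopes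
N2–N3, transfer rows N5, sources N6–N7 per degree), the row's data (jump rows `cWJ k k′` with the envelope `≤ C_J·2^{dk−1−dk′}`, base `B₀` N8, coarse born profiles
N6), the one-volume majorant profiles (N4 in the scaling `32(cW²/8)^m`), the soft kit conditions at `(σ̄, τ̄, ψ̄, Φ̄)`, the four-piece shape of the difference profile
`Y`, the step-image envelopes `C₃(p) ≤ C p` (`p ≥ 3`), `C_low(p) ≤ C p` (`p ≤ 2`), the source budgets `src ≤ R k·S`, `sμ ≤ R k·ΔX` (block 0 = N13 sits in `sμ`), and the
closing arithmetic `χ_m < Θ`, `a_mχ_mX_b/(1−χ_m/Θ) + ΔX ≤ Y`, `C + S ≤ Θ·X_b`.  CONCLUSION: for `2 ≤ κ ≤ K_b`, `1 ≤ p ≤ D`,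
`klLipBornDiffSup … d (κ−1) (2p) (R_out(κ−1)) ≤ R₁Θ^{κ−1}·X_b p·(ε·klLevUnitF β M 0 p (d(κ−1)))`, and the measured difference arrays obey `≤ R₁Θ^{k−1}·Y m`.
Nothing about the model is asserted beyond the named rows; nothing asserts stub (e), VL, K3 or superconductivity. [cite: BenfattoGiulianiMastropietro2006, §2.8 (2.93)-(2.98), §3] -/
theorem klLipBornDiffSup_le_law_of_rows {β : ℝ} (hβ : 0 < β) (U μ : ℝ) (K : TrigPolyC4v) {d : ℕ} (hd : 2 ≤ d) (jw jr Kb : ℕ) {D : ℕ} (hD3 : 3 ≤ D)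
    -- depth schedule
    (Din : ℕ → ℕ) (R' r : ℕ) (hDin : ∀ k, 2 * r ≤ Din k) (hdepth : ∀ k k', 1 ≤ k' → k' < k → Din k' + r + R' + r ≤ Din k)
    -- N1 tokens
    (hZf : ∀ k, 1 ≤ k → k < Kb → hubbardEffPartitionFnCT (b * L) M β U μ 0 K (klScale klE0 (d * k)) ≠ 0)
    (hZc : ∀ k, 1 ≤ k → k < Kb → hubbardEffPartitionFnCT L M β U μ 0 K (klScale klE0 (d * k)) ≠ 0)
    -- N2/N3 Gram and glued-weight decay envelopes of the FINE block covariances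
    {κb αb : ℝ} (hκb : 0 < κb) (hαb : 0 < αb) (κk αk : ℕ → ℝ) (hκ : ∀ k, 1 ≤ k → k < Kb → 0 < κk k) (hκκb : ∀ k, 1 ≤ k → k < Kb → κk k ^ 2 * (8 : ℝ) ^ (d * k) ≤ κb ^ 2)
    (hGB : ∀ k, 1 ≤ k → k < Kb → IsGramBoundedR ((sectorSubMatrix (b * L) M β (bgmFatMultiplier (b * L) M klE0 β (nambuXiCT (b * L) μ K) (d * k - 1))).transpose * hubbardCovSliceCT (b * L) M β μ 0 K (klScale klE0 (d * (k + 1))) (klScale klE0 (d * k)) * sectorSubMatrix (b * L) M β (bgmFatMultiplier (b * L) M klE0 β (nambuXiCT (b * L) μ K) (d * k - 1))) (κk k))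
    (hααb : ∀ k, 1 ≤ k → k < Kb → αk k ≤ αb * (4 : ℝ) ^ (d * k))
    (hrow : ∀ k, 1 ≤ k → k < Kb → ∀ X, ∑ Y, ‖((sectorSubMatrix (b * L) M β (bgmFatMultiplier (b * L) M klE0 β (nambuXiCT (b * L) μ K) (d * k - 1))).transpose * hubbardCovSliceCT (b * L) M β μ 0 K (klScale klE0 (d * (k + 1))) (klScale klE0 (d * k)) * sectorSubMatrix (b * L) M β (bgmFatMultiplier (b * L) M klE0 β (nambuXiCT (b * L) μ K) (d * k - 1))) X Y‖ * klGluedWt L b M β jw (sectorCount (d * k - 1)) {X, Y} ≤ αk k)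
    (hcol : ∀ k, 1 ≤ k → k < Kb → ∀ Y, ∑ X, ‖((sectorSubMatrix (b * L) M β (bgmFatMultiplier (b * L) M klE0 β (nambuXiCT (b * L) μ K) (d * k - 1))).transpose * hubbardCovSliceCT (b * L) M β μ 0 K (klScale klE0 (d * (k + 1))) (klScale klE0 (d * k)) * sectorSubMatrix (b * L) M β (bgmFatMultiplier (b * L) M klE0 β (nambuXiCT (b * L) μ K) (d * k - 1))) X Y‖ * klGluedWt L b M β jw (sectorCount (d * k - 1)) {X, Y} ≤ αk k)
    (hDk : ∀ k, 1 ≤ k → k < Kb → Fintype.card (SpaceTimeIdx (b * L) M × SectorLeg (sectorCount (d * k - 1))) / 2 ≤ D)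
    -- zone constant and N5 transfer rows (one step)
    {Λ : ℝ} (hΛ1 : 1 ≤ Λ) (hΛle : Λ ≤ 1 + klScale klE0 jw * ((R' : ℝ) + 1))
    {ΛT cW : ℝ} (hΛT : 0 ≤ ΛT) (hΛr : ΛT ≤ klScale klE0 jr) (hcW : 0 < cW)
    (hrowT : ∀ k, 1 ≤ k → k < Kb → ∀ x, ∑ y', ‖klLipTransfer (b * L) M β μ K d k x y'‖ *
      klScaleWt (b * L) M β jr {latticeLegPos (2 * (2 * M)) x, latticeLegPos (2 * (2 * M)) y'} ≤ cW)
    (hcolT : ∀ k, 1 ≤ k → k < Kb → ∀ y', ∑ x, ‖klLipTransfer (b * L) M β μ K d k x y'‖ *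
      klScaleWt (b * L) M β jr {latticeLegPos (2 * (2 * M)) x, latticeLegPos (2 * (2 * M)) y'} ≤ cW)
    -- N6/N7 step sources per block and degree (degree `2p`, `n = 2p − 1`)
    (Ns Nfar Es NDs : ℕ → ℕ → ℝ) (hNs0 : ∀ k p, 0 ≤ Ns k p) (hNfar0 : ∀ k p, 0 ≤ Nfar k p) (hEs0 : ∀ k p, 0 ≤ Es k p) (hNDs0 : ∀ k p, 0 ≤ NDs k p)
    (hNs : ∀ k, 1 ≤ k → k < Kb → ∀ p, 1 ≤ p → p ≤ D → ∀ (q : Fin ((2 * p - 1) + 1)) y, ∑ Y ∈ univ.filter (fun Y : Fin ((2 * p - 1) + 1) → (SpaceTimeIdx L M × SectorLeg (sectorCount (d * k - 1))) => Y q = y),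
      ‖kernel ℂ (effAction ℂ (klLipCov L M β μ K d k) (klLipInput L M β U μ K d k) - klLipInput L M β U μ K d k) ((2 * p - 1) + 1) Y‖ ≤ Ns k p)
    (hNfar : ∀ k, 1 ≤ k → k < Kb → ∀ p, 1 ≤ p → p ≤ D → ∀ (q : Fin ((2 * p - 1) + 1)) y (i : Fin ((2 * p - 1) + 1)),
      ∑ Y ∈ univ.filter (fun Y : Fin ((2 * p - 1) + 1) → (SpaceTimeIdx L M × SectorLeg (sectorCount (d * k - 1))) => Y q = y ∧ r < Torus.tnorm ((Y q).1.2 - (Y i).1.2)),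
        ‖kernel ℂ (effAction ℂ (klLipCov L M β μ K d k) (klLipInput L M β U μ K d k) - klLipInput L M β U μ K d k) ((2 * p - 1) + 1) Y‖ ≤ Nfar k p)
    (hEs : ∀ k, 1 ≤ k → k < Kb → ∀ p, 1 ≤ p → p ≤ D → ∀ (q : Fin ((2 * p - 1) + 1)) (y' : (SpaceTimeIdx (b * L) M × SectorLeg (sectorCount (d * k - 1)))), y' ∈ klDeepPins L (Din k + r + R') →
      ∑ Y' ∈ univ.filter (fun Y' : Fin ((2 * p - 1) + 1) → (SpaceTimeIdx (b * L) M × SectorLeg (sectorCount (d * k - 1))) => Y' q = y'),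
        ‖kernel ℂ ((effAction ℂ (klLipCov (b * L) M β μ K d k) (klGlue L b M (sectorCount (d * k - 1)) (klLipInput L M β U μ K d k)) -
              klGlue L b M (sectorCount (d * k - 1)) (klLipInput L M β U μ K d k)) -
            klGlue L b M (sectorCount (d * k - 1))
              (effAction ℂ (klLipCov L M β μ K d k) (klLipInput L M β U μ K d k) - klLipInput L M β U μ K d k)) ((2 * p - 1) + 1) Y'‖ ≤ Es k p)
    (hNDs : ∀ k, 1 ≤ k → k < Kb → ∀ p, 1 ≤ p → p ≤ D → ∀ (q : Fin ((2 * p - 1) + 1)) (y' : (SpaceTimeIdx (b * L) M × SectorLeg (sectorCount (d * k - 1)))),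
      ∑ Y' ∈ univ.filter (fun Y' : Fin ((2 * p - 1) + 1) → (SpaceTimeIdx (b * L) M × SectorLeg (sectorCount (d * k - 1))) => Y' q = y'),
        ‖kernel ℂ ((effAction ℂ (klLipCov (b * L) M β μ K d k) (klGlue L b M (sectorCount (d * k - 1)) (klLipInput L M β U μ K d k)) -
              klGlue L b M (sectorCount (d * k - 1)) (klLipInput L M β U μ K d k)) -
            klGlue L b M (sectorCount (d * k - 1))
              (effAction ℂ (klLipCov L M β μ K d k) (klLipInput L M β U μ K d k) - klLipInput L M β U μ K d k)) ((2 * p - 1) + 1) Y'‖ ≤ NDs k p)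
    -- the row's data: jump rows of `klJump (bL) (dk−1) (dk′)` with envelope, base (N8 + N13 inside the source), coarse born profiles (N6)
    (cWJ : ℕ → ℕ → ℝ) (hcWJ0 : ∀ k k', 0 ≤ cWJ k k') {CJ : ℝ}
    (hrowJ : ∀ k, 1 ≤ k → k < Kb → ∀ k' ∈ range k, ∀ x, ∑ y', ‖klJump (b * L) M β μ K (d * k - 1) (d * k') x y'‖ *
      klScaleWt (b * L) M β jr {latticeLegPos (2 * (2 * M)) x, latticeLegPos (2 * (2 * M)) y'} ≤ cWJ k k')
    (hcolJ : ∀ k, 1 ≤ k → k < Kb → ∀ k' ∈ range k, ∀ y', ∑ x, ‖klJump (b * L) M β μ K (d * k - 1) (d * k') x y'‖ *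
      klScaleWt (b * L) M β jr {latticeLegPos (2 * (2 * M)) x, latticeLegPos (2 * (2 * M)) y'} ≤ cWJ k k')
    (hcWenv : ∀ k k', 1 ≤ k' → k' < k → k < Kb → cWJ k k' ≤ CJ * (2 : ℝ) ^ (d * k - 1 - d * k'))
    (B₀ : ℕ → ℕ → ℝ) (hB₀0 : ∀ k m, 0 ≤ B₀ k m)
    (hbase : ∀ k, 1 ≤ k → k < Kb → ∀ m, 1 ≤ m → m ≤ D → ∀ (q : Fin ((2 * m - 1) + 1)) (w : (SpaceTimeIdx (b * L) M × SectorLeg (sectorCount (d * k - 1)))), w ∈ klDeepPins L (Din k + r) →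
      ∑ X ∈ univ.filter (fun X : Fin ((2 * m - 1) + 1) → (SpaceTimeIdx (b * L) M × SectorLeg (sectorCount (d * k - 1))) => X q = w),
        ‖kernel ℂ (sectorPreimage β (klAnisoFamily (b * L) M β μ K klE0 (d * k - 1)) (klEffectiveAction (b * L) M β U μ K klE0 0) -
            klGlue L b M (sectorCount (d * k - 1))
              (sectorPreimage β (klAnisoFamily L M β μ K klE0 (d * k - 1)) (klEffectiveAction L M β U μ K klE0 0))) ((2 * m - 1) + 1) X‖ ≤ B₀ k m)
    (NB NBfar : ℕ → ℕ → ℝ) (hNB0 : ∀ k' m, 0 ≤ NB k' m) (hNBfar0 : ∀ k' m, 0 ≤ NBfar k' m)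
    (hNB : ∀ k', k' < Kb → ∀ m, 1 ≤ m → m ≤ D → ∀ (q : Fin ((2 * m - 1) + 1)) (y : SpaceTimeIdx L M × SectorLeg (sectorCount (d * k'))),
      ∑ Y ∈ univ.filter (fun Y : Fin ((2 * m - 1) + 1) → SpaceTimeIdx L M × SectorLeg (sectorCount (d * k')) => Y q = y),
        ‖kernel ℂ (klLipBorn L M β U μ K d k') ((2 * m - 1) + 1) Y‖ ≤ NB k' m)
    (hNBfar : ∀ k', k' < Kb → ∀ m, 1 ≤ m → m ≤ D → ∀ (q : Fin ((2 * m - 1) + 1)) (y : SpaceTimeIdx L M × SectorLeg (sectorCount (d * k'))) (i : Fin ((2 * m - 1) + 1)),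
      ∑ Y ∈ univ.filter (fun Y : Fin ((2 * m - 1) + 1) → SpaceTimeIdx L M × SectorLeg (sectorCount (d * k')) =>
          Y q = y ∧ r < Torus.tnorm ((Y q).1.2 - (Y i).1.2)), ‖kernel ℂ (klLipBorn L M β U μ K d k') ((2 * m - 1) + 1) Y‖ ≤ NBfar k' m)
    -- N4 the one-volume majorant's four-piece profile, and the soft kit conditions at the LINK's constants
    {lam Q' A' ι₁ ι₂ ι₃ Aν κ₁ κ₂ κ₃ : ℝ} (hlam : 0 < lam) (hQ' : 0 < Q') (hA' : 0 ≤ A') (hAν : 0 ≤ Aν) (hκ₁0 : 0 ≤ κ₁) (hκ₂0 : 0 ≤ κ₂) (hκ₃0 : 0 ≤ κ₃)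
    (hμι₁ : ∀ k, 1 ≤ k → k < Kb → 32 * ((cW ^ 2 / 8) ^ 1 * (klTowerMeasWtAt L M β U μ K d k jw (2 * 1) / klLevUnitF β M 0 1 (d * k - 1) + (klTowerMeasWtAt (b * L) M β U μ K d k jw (2 * 1) / klLevUnitF β M 0 1 (d * k - 1) + klTowerMeasWtAt L M β U μ K d k jw (2 * 1) / klLevUnitF β M 0 1 (d * k - 1)) + klLipInputDiffSup L b M β U μ K d k (2 * 1) (Din k + r) / (imagTimeWeight β M * klLevUnitF β M 0 1 (d * k - 1)))) ≤ ι₁ * lam) (hμι₂ : ∀ k, 1 ≤ k → k < Kb → 32 * ((cW ^ 2 / 8) ^ 2 * (klTowerMeasWtAt L M β U μ K d k jw (2 * 2) / klLevUnitF β M 0 2 (d * k - 1) + (klTowerMeasWtAt (b * L) M β U μ K d k jw (2 * 2) / klLevUnitF β M 0 2 (d * k - 1) + klTowerMeasWtAt L M β U μ K d k jw (2 * 2) / klLevUnitF β M 0 2 (d * k - 1)) + klLipInputDiffSup L b M β U μ K d k (2 * 2) (Din k + r) / (imagTimeWeight β M * klLevUnitF β M 0 2 (d * k - 1)))) ≤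 ι₂ * lam) (hμι₃ : ∀ k, 1 ≤ k → k < Kb → 32 * ((cW ^ 2 / 8) ^ 3 * (klTowerMeasWtAt L M β U μ K d k jw (2 * 3) / klLevUnitF β M 0 3 (d * k - 1) + (klTowerMeasWtAt (b * L) M β U μ K d k jw (2 * 3) / klLevUnitF β M 0 3 (d * k - 1) + klTowerMeasWtAt L M β U μ K d k jw (2 * 3) / klLevUnitF β M 0 3 (d * k - 1)) + klLipInputDiffSup L b M β U μ K d k (2 * 3) (Din k + r) / (imagTimeWeight β M * klLevUnitF β M 0 3 (d * k - 1)))) ≤ ι₃ * lam ^ 2)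
    (hμprof : ∀ k, 1 ≤ k → k < Kb → ∀ m, 4 ≤ m → m ≤ D → 32 * ((cW ^ 2 / 8) ^ m * (klTowerMeasWtAt L M β U μ K d k jw (2 * m) / klLevUnitF β M 0 m (d * k - 1) + (klTowerMeasWtAt (b * L) M β U μ K d k jw (2 * m) / klLevUnitF β M 0 m (d * k - 1) + klTowerMeasWtAt L M β U μ K d k jw (2 * m) / klLevUnitF β M 0 m (d * k - 1)) + klLipInputDiffSup L b M β U μ K d k (2 * m) (Din k + r) / (imagTimeWeight β M * klLevUnitF β M 0 m (d * k - 1)))) ≤ A' * lam ^ (m - 1) * Q' ^ m)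
    (hx₁ : 4 * (κb ^ 2 * imagTimeWeight β M ^ 2 / cW ^ 2) * lam * Q' < 1) (hx₂ : 2 * lam * (4 * Real.exp 4 * κb ^ 2 * imagTimeWeight β M ^ 2 / cW ^ 2) * Q' ≤ 1) (hx₃ : Real.exp 1 * (4 * Real.exp 4 * κb ^ 2 * imagTimeWeight β M ^ 2 / cW ^ 2) * lam * Q' < 1) (hxτ : (4 * Real.exp 4 * κb ^ 2 * imagTimeWeight β M ^ 2 / cW ^ 2) * lam * Q' < 1)
    (hy : (Real.exp 1 * αb / κb ^ 2) * ((4 * Real.exp 4 * κb ^ 2 * imagTimeWeight β M ^ 2 / cW ^ 2) * (ι₁ * lam + ι₂ / (2 * Q') + ι₃ / (4 * Q' ^ 2) + A' * Q' / 4)) < 1) (hy₁ : (Real.exp 1 * αb / κb ^ 2) * ((4 * Real.exp 4 * κb ^ 2 * imagTimeWeight β M ^ 2 / cW ^ 2) * (ι₁ * lam) + (4 * Real.exp 4 * κb ^ 2 * imagTimeWeight β M ^ 2 / cW ^ 2) ^ 2 * (ι₂ * lam) + (4 * Real.exp 4 * κb ^ 2 * imagTimeWeight β M ^ 2 / cW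 ^ 2) ^ 3 * (ι₃ * lam ^ 2) + A' * ((4 * Real.exp 4 * κb ^ 2 * imagTimeWeight β M ^ 2 / cW ^ 2) * Q') * (((4 * Real.exp 4 * κb ^ 2 * imagTimeWeight β M ^ 2 / cW ^ 2) * lam * Q') ^ 3 / (1 - (4 * Real.exp 4 * κb ^ 2 * imagTimeWeight β M ^ 2 / cW ^ 2) * lam * Q'))) < 1) (hθ : (Real.exp 1 * αb / κb ^ 2) * (Real.exp 1 * (4 * Real.exp 4 * κb ^ 2 * imagTimeWeight β M ^ 2 / cW ^ 2) * (ι₁ * lam) + (Real.exp 1 * (4 * Real.exp 4 * κb ^ 2 * imagTimeWeight β M ^ 2 / cW ^ 2)) ^ 2 * (ι₂ * lam) + (Real.exp 1 * (4 * Real.exp 4 * κb ^ 2 * imagTimeWeight β M ^ 2 / cW ^ 2)) ^ 3 * (ι₃ * lam ^ 2) + A' * (Real.exp 1 * (4 * Real.exp 4 * κb ^ 2 * imagTimeWeight β M ^ 2 / cW ^ 2) * Q') * ((Real.exp 1 * (4 * Real.exp 4 * κb ^ 2 * imagTimeWeight β M ^ 2 / cW ^ 2) * lam * Q') ^ 3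 / (1 - Real.exp 1 * (4 * Real.exp 4 * κb ^ 2 * imagTimeWeight β M ^ 2 / cW ^ 2) * lam * Q'))) < 1)
    -- the budget and the closing arithmetic of `towerDiff_le_of_geomBudget`
    {Xb Yp C S ΔX : ℕ → ℝ} {R₁ Θ : ℝ} (hΘ : 1 ≤ Θ) (hR₁ : 0 ≤ R₁) (hXb0 : ∀ m, 0 ≤ Xb m)
    (hχΘ : ∀ m, 1 ≤ m → m ≤ D → (fun m : ℕ => (((32 : ℝ) / 2 ^ m) ^ d)) m < Θ)
    (hYenv : ∀ m, 1 ≤ m → m ≤ D → (fun m : ℕ => (2 * (cW ^ 2 / 8) * CJ ^ 2) ^ m) m * (fun m : ℕ => (((32 : ℝ) / 2 ^ m) ^ d)) m * Xb m / (1 - (fun m : ℕ => (((32 : ℝ) / 2 ^ m) ^ d)) m / Θ) + ΔX m ≤ Yp m)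
    (hY1 : Yp 1 ≤ κ₁ * lam) (hY2 : Yp 2 ≤ κ₂ * lam) (hY3 : Yp 3 ≤ κ₃ * lam ^ 2) (hYm : ∀ m, 4 ≤ m → m ≤ D → Yp m ≤ Aν * lam ^ (m - 1) * Q' ^ m)
    (hC3 : ∀ p, 3 ≤ p → p ≤ D → (Aν * lam ^ (p - 1) * (4 * Q') ^ p * (4 * (κb ^ 2 * imagTimeWeight β M ^ 2 / cW ^ 2) * lam * Q' / (1 - 4 * (κb ^ 2 * imagTimeWeight β M ^ 2 / cW ^ 2) * lam * Q')) + Real.exp 1 * (cW ^ 2 / (κb ^ 2 * imagTimeWeight β M ^ 2)) ^ p * (2 * (4 * Real.exp 4 * κb ^ 2 * imagTimeWeight β M ^ 2 / cW ^ 2) * Q' * lam) ^ (p - 1) * ((4 * Real.exp 4 * κb ^ 2 * imagTimeWeight β M ^ 2 / cW ^ 2) * (κ₁ * lam + κ₂ / (2 * Q') + κ₃ / (4 * Q' ^ 2) + Aν * Q' / 4)) * ((2 * ((Real.exp 1 * αb / κb ^ 2) * ((4 * Real.exp 4 * κb ^ 2 * imagTimeWeight β M ^ 2 / cW ^ 2)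 * (ι₁ * lam + ι₂ / (2 * Q') + ι₃ / (4 * Q' ^ 2) + A' * Q' / 4))) - ((Real.exp 1 * αb / κb ^ 2) * ((4 * Real.exp 4 * κb ^ 2 * imagTimeWeight β M ^ 2 / cW ^ 2) * (ι₁ * lam + ι₂ / (2 * Q') + ι₃ / (4 * Q' ^ 2) + A' * Q' / 4))) ^ 2) / (1 - (Real.exp 1 * αb / κb ^ 2) * ((4 * Real.exp 4 * κb ^ 2 * imagTimeWeight β M ^ 2 / cW ^ 2) * (ι₁ * lam + ι₂ / (2 * Q') + ι₃ / (4 * Q' ^ 2) + A' * Q' / 4))) ^ 2)) ≤ C p)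
    (hC12 : ∀ p, 1 ≤ p → p ≤ 2 → ((Aν + κ₁ * lam / Q' + κ₂ / Q' ^ 2 + κ₃ / Q' ^ 3) * lam ^ (p - 1) * (4 * Q') ^ p * (4 * (κb ^ 2 * imagTimeWeight β M ^ 2 / cW ^ 2) * lam * Q' / (1 - 4 * (κb ^ 2 * imagTimeWeight β M ^ 2 / cW ^ 2) * lam * Q')) + Real.exp 1 * (cW ^ 2 / (κb ^ 2 * imagTimeWeight β M ^ 2)) ^ p * ((4 * Real.exp 4 * κb ^ 2 * imagTimeWeight β M ^ 2 / cW ^ 2) * (κ₁ * lam) + (4 * Real.exp 4 * κb ^ 2 * imagTimeWeight β M ^ 2 / cW ^ 2) ^ 2 * (κ₂ * lam) + (4 * Real.exp 4 * κb ^ 2 * imagTimeWeight β M ^ 2 / cW ^ 2) ^ 3 * (κ₃ * lam ^ 2) + Aν * ((4 * Real.exp 4 * κb ^ 2 * imagTimeWeight β M ^ 2 / cW ^ 2) * Q') * (((4 * Real.exp 4 * κb ^ 2 * imagTimeWeight β M ^ 2 / cW ^ 2) * lam * Q') ^ 3 / (1 - (4 * Real.exp 4 * κb ^ 2 * imagTimeWeight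 β M ^ 2 / cW ^ 2) * lam * Q'))) * ((2 * ((Real.exp 1 * αb / κb ^ 2) * ((4 * Real.exp 4 * κb ^ 2 * imagTimeWeight β M ^ 2 / cW ^ 2) * (ι₁ * lam) + (4 * Real.exp 4 * κb ^ 2 * imagTimeWeight β M ^ 2 / cW ^ 2) ^ 2 * (ι₂ * lam) + (4 * Real.exp 4 * κb ^ 2 * imagTimeWeight β M ^ 2 / cW ^ 2) ^ 3 * (ι₃ * lam ^ 2) + A' * ((4 * Real.exp 4 * κb ^ 2 * imagTimeWeight β M ^ 2 / cW ^ 2) * Q') * (((4 * Real.exp 4 * κb ^ 2 * imagTimeWeight β M ^ 2 / cW ^ 2) * lam * Q') ^ 3 / (1 - (4 * Real.exp 4 * κb ^ 2 * imagTimeWeight β M ^ 2 / cW ^ 2) * lam * Q')))) - ((Real.exp 1 * αb / κb ^ 2) * ((4 * Real.exp 4 * κb ^ 2 * imagTimeWeight β M ^ 2 / cW ^ 2) * (ι₁ * lam) + (4 * Real.exp 4 * κb ^ 2 * imagTimeWeight β M ^ 2 / cW ^ 2) ^ 2 * (ι₂ * lam) + (4 * Real.exp 4 * κb ^ 2 *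 imagTimeWeight β M ^ 2 / cW ^ 2) ^ 3 * (ι₃ * lam ^ 2) + A' * ((4 * Real.exp 4 * κb ^ 2 * imagTimeWeight β M ^ 2 / cW ^ 2) * Q') * (((4 * Real.exp 4 * κb ^ 2 * imagTimeWeight β M ^ 2 / cW ^ 2) * lam * Q') ^ 3 / (1 - (4 * Real.exp 4 * κb ^ 2 * imagTimeWeight β M ^ 2 / cW ^ 2) * lam * Q')))) ^ 2) / (1 - (Real.exp 1 * αb / κb ^ 2) * ((4 * Real.exp 4 * κb ^ 2 * imagTimeWeight β M ^ 2 / cW ^ 2) * (ι₁ * lam) + (4 * Real.exp 4 * κb ^ 2 * imagTimeWeight β M ^ 2 / cW ^ 2) ^ 2 * (ι₂ * lam) + (4 * Real.exp 4 * κb ^ 2 * imagTimeWeight β M ^ 2 / cW ^ 2) ^ 3 * (ι₃ * lam ^ 2) + A' * ((4 * Real.exp 4 * κb ^ 2 * imagTimeWeight β M ^ 2 / cW ^ 2) * Q') * (((4 * Real.exp 4 * κb ^ 2 * imagTimeWeight β M ^ 2 / cW ^ 2) * lam * Q') ^ 3 / (1 - (4 * Real.exp 4 * κb ^ 2 * imagTimeWeight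 β M ^ 2 / cW ^ 2) * lam * Q')))) ^ 2)) ≤ C p)
    (hCS : ∀ p, 1 ≤ p → p ≤ D → C p + S p ≤ Θ * Xb p)
    (hsrc : ∀ k, 1 ≤ k → k < Kb → ∀ p, 1 ≤ p → p ≤ D → (cW ^ (2 * p - 1) * (cW * Es k p + cW / (1 + ΛT * ((r : ℝ) + 1)) * NDs k p) + (2 * cW ^ (2 * p - 1) * (cW / (1 + ΛT * ((r : ℝ) + 1))) * Ns k p + (((2 * p - 1) : ℕ) : ℝ) * cW ^ (2 * p - 1) * (5 * (cW / (1 + ΛT * ((r : ℝ) + 1))) * Ns k p + 2 * cW * Nfar k p))) / (imagTimeWeight β M * klLevUnitF β M 0 p (d * k)) ≤ R₁ * Θ ^ (k - 1) * S p)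
    (hsμ : ∀ k, 1 ≤ k → k < Kb → ∀ m, 1 ≤ m → m ≤ D → (32 * (cW ^ 2 / 8) ^ m * (B₀ k m + (cWJ k 0 ^ (2 * m - 1) * (cWJ k 0 * klLipBornDiffSup L b M β U μ K d 0 (2 * m) (Din k)) + (cWJ k 0 ^ (2 * m - 1) * ((cWJ k 0 / (1 + ΛT * ((r : ℝ) + 1))) * klLipBornDiffSup L b M β U μ K d 0 (2 * m) 0) + (2 * cWJ k 0 ^ (2 * m - 1) * (cWJ k 0 / (1 + ΛT * ((r : ℝ) + 1))) * NB 0 m + (((2 * m - 1) : ℕ) : ℝ) * cWJ k 0 ^ (2 * m - 1) * (5 * (cWJ k 0 / (1 + ΛT * ((r : ℝ) + 1))) * NB 0 m + 2 * cWJ k 0 * NBfar 0 m)))) + ∑ k' ∈ Ico 1 k, (cWJ k k' ^ (2 * m - 1) * ((cWJ k k' / (1 + ΛT * ((r : ℝ) + 1))) * klLipBornDiffSup L b M β U μ K d k' (2 * m) 0) + (2 * cWJ k k' ^ (2 * m - 1) * (cWJ k k' / (1 + ΛT * ((r : ℝ) + 1))) * NB k' m + (((2 * m - 1) : ℕ)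 : ℝ) * cWJ k k' ^ (2 * m - 1) * (5 * (cWJ k k' / (1 + ΛT * ((r : ℝ) + 1))) * NB k' m + 2 * cWJ k k' * NBfar k' m)))) / (imagTimeWeight β M * klLevUnitF β M 0 m (d * k - 1)) + 32 * ((cW ^ 2 / 8) ^ m * ((Λ⁻¹ + 1 / (1 + ΛT * ((r : ℝ) + 1))) * (klTowerMeasWtAt (b * L) M β U μ K d k jw (2 * m) / klLevUnitF β M 0 m (d * k - 1) + klTowerMeasWtAt L M β U μ K d k jw (2 * m) / klLevUnitF β M 0 m (d * k - 1))))) ≤ R₁ * Θ ^ (k - 1) * ΔX m) :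
    (∀ κ, 2 ≤ κ → κ ≤ Kb → ∀ p, 1 ≤ p → p ≤ D →
      klLipBornDiffSup L b M β U μ K d (κ - 1) (2 * p) (Din (κ - 1) + r + R' + r) ≤ R₁ * Θ ^ (κ - 1) * Xb p * (imagTimeWeight β M * klLevUnitF β M 0 p (d * (κ - 1)))) ∧
    (∀ k, 1 ≤ k → k < Kb → ∀ m, 1 ≤ m → m ≤ D → 32 * ((cW ^ 2 / 8) ^ m * (klLipInputDiffSup L b M β U μ K d k (2 * m) (Din k + r) / (imagTimeWeight β M * klLevUnitF β M 0 m (d * k - 1)) + (Λ⁻¹ + 1 / (1 + ΛT * ((r : ℝ) + 1))) * (klTowerMeasWtAt (b * L) M β U μ K d k jw (2 * m) / klLevUnitF β M 0 m (d * k - 1) + klTowerMeasWtAt L M β U μ K d k jw (2 * m) / klLevUnitF β M 0 m (d * k - 1)))) ≤ R₁ * Θ ^ (k - 1) * Yp m) := by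
  have hx : 0 < imagTimeWeight β M := imagTimeWeight_pos_of_pos (M := M) hβ
  have hd1 : 1 ≤ d := by omega
  have hZ : (0 : ℝ) ≤ cW ^ 2 / 8 := by positivity
  have hΛinv : 0 ≤ Λ⁻¹ := inv_nonneg.2 (zero_le_one.trans hΛ1)
  have hG0 : 0 ≤ (Λ⁻¹ + 1 / (1 + ΛT * ((r : ℝ) + 1))) := by positivity
  -- the arrays of `towerDiff_le_of_geomBudget`
  have key := towerDiff_le_of_geomBudget (D := D) (K := Kb)
    (db := (fun κ p => if κ < 2 then (0 : ℝ) else klLipBornDiffSup L b M β U μ K d (κ - 1) (2 * p) (Din (κ - 1) + r + R' + r) / (imagTimeWeight β M * klLevUnitF β M 0 p (d * (κ - 1)))))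
    (dμ := fun k m => 32 * ((cW ^ 2 / 8) ^ m * (klLipInputDiffSup L b M β U μ K d k (2 * m) (Din k + r) / (imagTimeWeight β M * klLevUnitF β M 0 m (d * k - 1)) + (Λ⁻¹ + 1 / (1 + ΛT * ((r : ℝ) + 1))) * (klTowerMeasWtAt (b * L) M β U μ K d k jw (2 * m) / klLevUnitF β M 0 m (d * k - 1) + klTowerMeasWtAt L M β U μ K d k jw (2 * m) / klLevUnitF β M 0 m (d * k - 1)))))
    (sμ := fun k m => (32 * (cW ^ 2 / 8) ^ m * (B₀ k m + (cWJ k 0 ^ (2 * m - 1) * (cWJ k 0 * klLipBornDiffSup L b M β U μ K d 0 (2 * m) (Din k)) + (cWJ k 0 ^ (2 * m - 1) * ((cWJ k 0 / (1 + ΛT * ((r : ℝ) + 1))) * klLipBornDiffSup L b M β U μ K d 0 (2 * m) 0) + (2 * cWJ k 0 ^ (2 * m - 1) * (cWJ k 0 / (1 + ΛT * ((r : ℝ) + 1))) * NB 0 m + (((2 * m - 1) : ℕ) : ℝ) * cWJ k 0 ^ (2 * m - 1) * (5 * (cWJ k 0 / (1 + ΛT * ((r : ℝ) + 1))) * NB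 0 m + 2 * cWJ k 0 * NBfar 0 m)))) + ∑ k' ∈ Ico 1 k, (cWJ k k' ^ (2 * m - 1) * ((cWJ k k' / (1 + ΛT * ((r : ℝ) + 1))) * klLipBornDiffSup L b M β U μ K d k' (2 * m) 0) + (2 * cWJ k k' ^ (2 * m - 1) * (cWJ k k' / (1 + ΛT * ((r : ℝ) + 1))) * NB k' m + (((2 * m - 1) : ℕ) : ℝ) * cWJ k k' ^ (2 * m - 1) * (5 * (cWJ k k' / (1 + ΛT * ((r : ℝ) + 1))) * NB k' m + 2 * cWJ k k' * NBfar k' m)))) / (imagTimeWeight β M * klLevUnitF β M 0 m (d * k - 1)) + 32 * ((cW ^ 2 / 8) ^ m * ((Λ⁻¹ + 1 / (1 + ΛT * ((r : ℝ) + 1))) * (klTowerMeasWtAt (b * L) M β U μ K d k jw (2 * m) / klLevUnitF β M 0 m (d * k - 1) + klTowerMeasWtAt L M β U μ K d k jw (2 * m) / klLevUnitF β M 0 m (d * k - 1))))))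
    (src := fun k p => (cW ^ (2 * p - 1) * (cW * Es k p + cW / (1 + ΛT * ((r : ℝ) + 1)) * NDs k p) + (2 * cW ^ (2 * p - 1) * (cW / (1 + ΛT * ((r : ℝ) + 1))) * Ns k p + (((2 * p - 1) : ℕ) : ℝ) * cW ^ (2 * p - 1) * (5 * (cW / (1 + ΛT * ((r : ℝ) + 1))) * Ns k p + 2 * cW * Nfar k p))) / (imagTimeWeight β M * klLevUnitF β M 0 p (d * k)))
    (Xb := Xb) (Y := Yp) (C := C) (S := S) (ΔX := ΔX) (a := (fun m : ℕ => (2 * (cW ^ 2 / 8) * CJ ^ 2) ^ m)) (χ := (fun m : ℕ => (((32 : ℝ) / 2 ^ m) ^ d))) (R₁ := R₁) (Θ := Θ)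
    hΘ hR₁ hXb0 (fun m => by positivity) (fun m => by positivity) hχΘ
    (fun k' hk' m => by simp only [if_pos hk']) ?_ hsμ hYenv ?_ hsrc hCS
  · -- read the conclusion
    refine ⟨fun κ hκ2 hκK p hp hpD => ?_, key.2⟩
    have h := key.1 κ hκ2 hκK p hp hpD
    simp only [show ¬ κ < 2 from not_lt.2 hκ2, if_false] at h
    have hU : 0 < imagTimeWeight β M * klLevUnitF β M 0 p (d * (κ - 1)) := mul_pos hx (klLevUnitF_pos hβ 0 _ _)
    rwa [div_le_iff₀ hU] at h
  · -- hrow := `lipDiffArray_row_le` at block `k`, degree `m`, plus the gain part of the difference array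
    intro k hk1 hkK m hm hmD
    have hq : 2 * m = (2 * m - 1) + 1 := by omega
    have hdbm : ∀ k', 1 ≤ k' → k' < k →
        klLipBornDiffSup L b M β U μ K d k' ((2 * m - 1) + 1) (Din k' + r + R' + r) ≤
          (fun κ p => if κ < 2 then (0 : ℝ) else klLipBornDiffSup L b M β U μ K d (κ - 1) (2 * p) (Din (κ - 1) + r + R' + r) / (imagTimeWeight β M * klLevUnitF β M 0 p (d * (κ - 1)))) (k' + 1) m * (imagTimeWeight β M * klLevUnitF β M 0 m (d * k')) := by
      intro k' hk'1 hk'k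
      have hU : 0 < imagTimeWeight β M * klLevUnitF β M 0 m (d * k') := mul_pos hx (klLevUnitF_pos hβ 0 _ _)
      simp only [show ¬ k' + 1 < 2 by omega, if_false, Nat.add_sub_cancel, ← hq]
      rw [div_mul_cancel₀ _ hU.ne']
    have hr := lipDiffArray_row_le (L := L) (b := b) (M := M) hβ U μ K hd hk1 hq (Din k) r jr (hDin k) hΛT hΛr (hcWJ0 k)
      (hrowJ k hk1 hkK) (hcolJ k hk1 hkK) (fun k' hk'1 hk'k => hcWenv k k' hk'1 hk'k hkK) (hB₀0 k m) (hbase k hk1 hkK m hm hmD)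
      (fun k' => hNB0 k' m) (fun k' => hNBfar0 k' m)
      (fun k' hk' => hNB k' ((mem_range.1 hk').trans hkK) m hm hmD) (fun k' hk' => hNBfar k' ((mem_range.1 hk').trans hkK) m hm hmD)
      (fun k' => (Din k' + r + R' + r)) (fun k' hk'1 hk'k => hdepth k k' hk'1 hk'k)
      (fun k'' => (fun κ p => if κ < 2 then (0 : ℝ) else klLipBornDiffSup L b M β U μ K d (κ - 1) (2 * p) (Din (κ - 1) + r + R' + r) / (imagTimeWeight β M * klLevUnitF β M 0 p (d * (κ - 1)))) k'' m) (fun k'' => by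
        dsimp only
        split_ifs
        · exact le_rfl
        · exact div_nonneg (klLipBornDiffSup_nonneg β U μ K d _ _ _) (mul_pos hx (klLevUnitF_pos hβ 0 _ _)).le) hdbm hZ
    rw [← hq] at hr
    have hGpart : 0 ≤ 32 * ((cW ^ 2 / 8) ^ m * ((Λ⁻¹ + 1 / (1 + ΛT * ((r : ℝ) + 1))) * (klTowerMeasWtAt (b * L) M β U μ K d k jw (2 * m) / klLevUnitF β M 0 m (d * k - 1) + klTowerMeasWtAt L M β U μ K d k jw (2 * m) / klLevUnitF β M 0 m (d * k - 1)))) := by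
      have h2 := klTowerMeasWtAt_nonneg hβ.le U μ K d k jw (2 * m) (L := b * L) (M := M)
      have h3 := klTowerMeasWtAt_nonneg hβ.le U μ K d k jw (2 * m) (L := L) (M := M)
      have h4 := klLevUnitF_pos hβ (M := M) 0 m (d * k - 1)
      positivity
    have hsplit : 32 * ((cW ^ 2 / 8) ^ m * (klLipInputDiffSup L b M β U μ K d k (2 * m) (Din k + r) / (imagTimeWeight β M * klLevUnitF β M 0 m (d * k - 1)) + (Λ⁻¹ + 1 / (1 + ΛT * ((r : ℝ) + 1))) * (klTowerMeasWtAt (b * L) M β U μ K d k jw (2 * m) / klLevUnitF β M 0 m (d * k - 1) + klTowerMeasWtAt L M β U μ K d k jw (2 * m) / klLevUnitF β M 0 m (d * k - 1)))) =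
        32 * (cW ^ 2 / 8) ^ m * klLipInputDiffSup L b M β U μ K d k (2 * m) (Din k + r) / (imagTimeWeight β M * klLevUnitF β M 0 m (d * k - 1)) +
          32 * ((cW ^ 2 / 8) ^ m * ((Λ⁻¹ + 1 / (1 + ΛT * ((r : ℝ) + 1))) * (klTowerMeasWtAt (b * L) M β U μ K d k jw (2 * m) / klLevUnitF β M 0 m (d * k - 1) + klTowerMeasWtAt L M β U μ K d k jw (2 * m) / klLevUnitF β M 0 m (d * k - 1)))) := by ring
    rw [hsplit]
    beta_reduce at hr
    linarith [hr]
  · -- hstep := `klLipBornDiffSup_le_budgetStep_{of_three_le, low}` at block `k`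
    intro k hk1 hkK hprof p hp hpD
    have hRk : 0 ≤ R₁ * Θ ^ (k - 1) := by positivity
    have hν₁ := (hprof 1 le_rfl (by omega)).trans (mul_le_mul_of_nonneg_left hY1 hRk)
    have hν₂ := (hprof 2 (by norm_num) (by omega)).trans (mul_le_mul_of_nonneg_left hY2 hRk)
    have hν₃ := (hprof 3 (by norm_num) hD3).trans (mul_le_mul_of_nonneg_left hY3 hRk)
    have hνprof : ∀ m, 4 ≤ m → m ≤ D → 32 * ((cW ^ 2 / 8) ^ m * (klLipInputDiffSup L b M β U μ K d k (2 * m) (Din k + r) / (imagTimeWeight β M * klLevUnitF β M 0 m (d * k - 1)) + (Λ⁻¹ + 1 / (1 + ΛT * ((r : ℝ) + 1))) * (klTowerMeasWtAt (b * L) M β U μ K d k jw (2 * m) / klLevUnitF β M 0 m (d * k - 1) + klTowerMeasWtAt L M β U μ K d k jw (2 * m) / klLevUnitF β M 0 m (d * k - 1)))) ≤ R₁ * Θ ^ (k - 1) * (Aν * lam ^ (m - 1) * Q' ^ m) :=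
      fun m hm4 hmD => (hprof m (by omega) hmD).trans (mul_le_mul_of_nonneg_left (hYm m hm4 hmD) hRk)
    have hq : 2 * p = (2 * p - 1) + 1 := by omega
    have hD₀ : 2 * r ≤ Din k + r + R' := by have := hDin k; omega
    have hdb : (if k + 1 < 2 then (0 : ℝ) else klLipBornDiffSup L b M β U μ K d (k + 1 - 1) (2 * p) (Din (k + 1 - 1) + r + R' + r) / (imagTimeWeight β M * klLevUnitF β M 0 p (d * (k + 1 - 1)))) =
        klLipBornDiffSup L b M β U μ K d k ((2 * p - 1) + 1) (Din k + r + R' + r) / (imagTimeWeight β M * klLevUnitF β M 0 p (d * k)) := by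
      simp only [show ¬ k + 1 < 2 by omega, if_false, Nat.add_sub_cancel, ← hq]
    rw [hdb]
    by_cases hp3 : 3 ≤ p
    · have h := klLipBornDiffSup_le_budgetStep_of_three_le (L := L) (b := b) (M := M) hβ U μ K jw hd1 hk1 (hZf k hk1 hkK) (hZc k hk1 hkK)
        (hκ k hk1 hkK) hκb (hκκb k hk1 hkK) (hGB k hk1 hkK) hαb (hααb k hk1 hkK) (hrow k hk1 hkK) (hcol k hk1 hkK) (hDk k hk1 hkK)
        (Din k + r) R' hΛ1 hΛle jr hΛT hΛr hcW (hrowT k hk1 hkK) (hcolT k hk1 hkK) (Din k + r + R') r hD₀ le_rfl hq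
        (hNs0 k p) (hNfar0 k p) (hEs0 k p) (hNDs0 k p) (hNs k hk1 hkK p hp hpD) (hNfar k hk1 hkK p hp hpD) (hEs k hk1 hkK p hp hpD) (hNDs k hk1 hkK p hp hpD)
        hp3 hlam hQ' hA' hAν hRk (hμι₁ k hk1 hkK) (hμι₂ k hk1 hkK) (hμι₃ k hk1 hkK) (hμprof k hk1 hkK) hν₁ hν₂ hν₃ hνprof hx₁ hx₂ hx₃ hy hθ
      exact h.trans (add_le_add (mul_le_mul_of_nonneg_left (hC3 p hp3 hpD) hRk) le_rfl)
    · have hp2 : p ≤ 2 := by omega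
      have h := klLipBornDiffSup_le_budgetStep_low (L := L) (b := b) (M := M) hβ U μ K jw hd1 hk1 (hZf k hk1 hkK) (hZc k hk1 hkK)
        (hκ k hk1 hkK) hκb (hκκb k hk1 hkK) (hGB k hk1 hkK) hαb (hααb k hk1 hkK) (hrow k hk1 hkK) (hcol k hk1 hkK) (hDk k hk1 hkK)
        (Din k + r) R' hΛ1 hΛle jr hΛT hΛr hcW (hrowT k hk1 hkK) (hcolT k hk1 hkK) (Din k + r + R') r hD₀ le_rfl hq
        (hNs0 k p) (hNfar0 k p) (hEs0 k p) (hNDs0 k p) (hNs k hk1 hkK p hp hpD) (hNfar k hk1 hkK p hp hpD) (hEs k hk1 hkK p hp hpD) (hNDs k hk1 hkK p hp hpD)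
        hlam hQ' hA' hAν hRk hκ₁0 hκ₂0 hκ₃0 (hμι₁ k hk1 hkK) (hμι₂ k hk1 hkK) (hμι₃ k hk1 hkK) (hμprof k hk1 hkK) hν₁ hν₂ hν₃ hνprof hx₁ hx₃ hy₁ hθ hxτ
      exact h.trans (add_le_add (mul_le_mul_of_nonneg_left (hC12 p hp hp2) hRk) le_rfl)

end Summit.HubbardSuperconductivity.HubbardSuperconductivity.Theorems.TwoVolumeLip

end
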